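import Summits.BirchSwinnertonDyer.BirchSwinnertonDyer.Theorems.PrintCFramBottomClassIndexLawFiveLeBorelDescentClaimB
import HarnessLib

/-!
# Route `PrintCFram`, crux C2 `BottomClassIndexLawFiveLe` (stmt-BirchSwinnertonDyer-20372), line
# `eisenstein-resource-bdp-line`, stub `stub_kolyvaginUpper_borelCM_pairSum_offKrizLi`:
# **KOLYVAGIN'S DESCENT UNDER THE BOREL ČEBOTAREV AXIOM, III — ANNIHILATION `p^{2M₀+1}·Sel ⊆ ℤx` AND `Ш`**
# (cell `bsd-print-cfram`, seat `bsd-line-cfram-p1-w2` g7; helper `--supports` 20372; 0 defs, 0 facts, 0 sorry)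

HONEST FRAMING. Nothing about BSD is proved here and nothing of the stub itself; pure algebra, sequel of
`…BorelDescentClaimA` (Claim A `p^{M₀+1}·Sel^{−ε} = 0`) and `…BorelDescentClaimB` (Claim B without Claim A,
`p^{2M₀+1}·Sel^{ε} ⊆ ℤx`, verbatim `p^{2M₀}` under one even-depth step-A class). Data (B1)–(B4) as there.

* `pow_zsmul_mem_zmultiples_borel` — **Kolyvagin's annihilation at the Borel CM-ramified prime (abstract):
  `p^{2M₀+1}·Sel ⊆ ℤx`** (eigen-decomposition, `p` odd). In the application (`V = H¹(K″, W[p^M])`,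
  `x = δ_M x₀`) this is `p^{2M₀+1} Ш(W/K″)_{p^M} = 0` for every `M`: the verbatim machine
  (`HypothesesM.pow_zsmul_mem_zmultiples`: `p^{2M₀}`) survives with ONE extra `p`-step.
* `pow_zsmul_eigen_mem_zmultiples_borel_of_even` — the `ε`-part keeps the verbatim `p^{2M₀}` given one
  even-depth step-A class; the `(−ε)`-part is where the Borel prime genuinely costs (depth-1 classes of sign
  `−ε` are blind: w2 g6 `…BorelKolyvaginBlind`).
* `finite_sha_primary_of_forall_pow_zsmul_mem_zmultiples` — generic passage to `Ш`: annihilation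
  `p^C·Sel^{(p^j)}(E/K) ⊆ ℤx_j` at every level with `x_j ∈ δ(E(K))` gives `p^C·Ш(E/K)[p^∞] = 0`, finite
  (the tree's `finite_sha_primary_of_hypothesesM` with the descent data abstracted to its output).

THEOREMS ONLY; no definition, no named fact, no `sorry`. BSD is not proved by any of this; no summit
statement is proved by this seat. References: [GrossLMS1991] Thm. 1.3, §10; [McCallumLMS1991] §1, §5;
[SilvermanAEC2009] Thm. X.4.2.
-/

set_option autoImplicit false
-- `…BirchSwinnertonDyer.BirchSwinnertonDyer.Theorems…` is the problem's mandated namespace (D-0017).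
set_option linter.dupNamespace false

noncomputable section

open scoped Classical

universe u

namespace Summit.BirchSwinnertonDyer.BirchSwinnertonDyer.Theorems.PrintCFram.BorelDescent

open WeierstrassCurve Literature.NumberTheory.EllipticCurves
  Literature.NumberTheory.EllipticCurves.KolyvaginDescent
  Summit.BirchSwinnertonDyer.BirchSwinnertonDyer.Theorems.SylvesterTwoUpper.DescentDefect

/-! ## §4 Annihilation: `p^{2M₀+1}·Sel ⊆ ℤx` -/

section Annihilation

variable {V : Type*} [AddCommGroup V] {Pl : Type*}
variable {p M M₀ : ℕ} {ε : ℤ} {τ : V →+ V} {Sel : AddSubgroup V} {Loc : Pl → AddSubgroup V}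
  {Kol : ℕ → Prop} {pl : ℕ → Pl} {Dv : Pl → ℕ → Prop} {A : ℕ → AddSubgroup V} {x : V} {c : ℕ → V}
  {dp : V → ℕ} {TopIndep : V → V → Prop}

/-- **Kolyvagin's annihilation at the Borel CM-ramified prime (abstract form): `p^{2M₀+1}·Sel ⊆ ℤx`.**
Eigen-decomposition `s = s⁺ + s⁻` (`p` odd, `Sel` `τ`-stable); `p^{M₀+1} s⁻ = 0` by Claim A,
`p^{2M₀+1} s⁺ ∈ ℤx` by Claim B. In the application (`V = H¹(K″, W[p^M])`, `x = δ_M x₀`) this is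
`p^{2M₀+1} S_{p^M}(W/K″) ⊆ δ_M(W(K″))`, hence `p^{2M₀+1} Ш(W/K″)_{p^M} = 0` for every `M`: exponent form of
Kolyvagin's theorem with ONE extra `p`-step — the verbatim descent survives at the Borel prime.
[cite: GrossLMS1991, Thm. 1.3 and §10] [cite: McCallumLMS1991, §1 Theorem (Kolyvagin), §5] -/
theorem pow_zsmul_mem_zmultiples_borel (hp : p.Prime) (hp2 : p ≠ 2) (hε : ε = 1 ∨ ε = -1)
    (htor : ∀ v : V, ((p : ℤ) ^ M) • v = 0) (hττ : ∀ v, τ (τ v) = v)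
    (hτSel : ∀ s ∈ Sel, τ s ∈ Sel) (hSel : ∀ s, s ∈ Sel ↔ ∀ v, s ∈ Loc v)
    (hKol : ∀ ℓ, Kol ℓ → ℓ.Prime) (hdv : ∀ ℓ, Kol ℓ → ∀ v, Dv v ℓ ↔ v = pl ℓ)
    (hdvm : ∀ ℓ ℓ', Kol ℓ → Kol ℓ' → ∀ v, Dv v (ℓ * ℓ') → Dv v ℓ ∨ Dv v ℓ')
    (hxSel : x ∈ Sel) (hxord : ((p : ℤ) ^ (M - 1)) • x ≠ 0) (hτx : τ x = ε • x)
    (hc1 : c 1 = ((p : ℤ) ^ M₀) • x)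
    (hτc : ∀ n, KolSupp Kol n → τ (c n) = (ε * (-1) ^ n.primeFactors.card) • c n)
    (hcloc : ∀ n, KolSupp Kol n → ∀ v, ¬ Dv v n → c n ∈ Loc v)
    (hc44 : ∀ ℓ m, Kol ℓ → KolSupp Kol (ℓ * m) → ∀ a : ℕ,
      (((p : ℤ) ^ a) • c (ℓ * m) ∈ Loc (pl ℓ)) ↔ ((p : ℤ) ^ a) • c m ∈ A ℓ)
    (hdual : ∀ ℓ, Kol ℓ → ∀ ν : ℤ, (ν = 1 ∨ ν = -1) → ∀ d, τ d = ν • d →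
      (∀ v, v ≠ pl ℓ → d ∈ Loc v) → ∀ s ∈ Sel, τ s = ν • s →
      ∀ a, a < M → ((p : ℤ) ^ a) • d ∉ Loc (pl ℓ) → ((p : ℤ) ^ (M - 1 - a)) • s ∈ A ℓ)
    (hdp : ∀ (v : V) (a : ℕ), ((p : ℤ) ^ a) • v = 0 ↔ dp v ≤ 2 * a)
    (hsplit : ∀ s, τ s = ε • s → ∃ (k : ℤ) (s' : V), s = k • x + s' ∧ TopIndep x s')
    (hceb1 : ∀ (u : V) (Nu : ℕ), u ≠ 0 → τ u = ε • u → 2 * Nu ≤ dp u + 1 →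
      ∀ b : ℕ, ∃ ℓ, b < ℓ ∧ Kol ℓ ∧ ((p : ℤ) ^ Nu) • u ∈ A ℓ ∧
        (Nu ≠ 0 → ((p : ℤ) ^ (Nu - 1)) • u ∉ A ℓ))
    (hceb2 : ∀ (u w : V) (Nu Nw : ℕ), u ≠ 0 → w ≠ 0 → τ u = ε • u → τ w = (-ε) • w →
      2 * Nu ≤ dp u + 1 → 2 * Nw ≤ dp w → ∀ b : ℕ, ∃ ℓ, b < ℓ ∧ Kol ℓ ∧
        (((p : ℤ) ^ Nu) • u ∈ A ℓ ∧ (Nu ≠ 0 → ((p : ℤ) ^ (Nu - 1)) • u ∉ A ℓ)) ∧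
        (((p : ℤ) ^ Nw) • w ∈ A ℓ ∧ (Nw ≠ 0 → ((p : ℤ) ^ (Nw - 1)) • w ∉ A ℓ)))
    (hceb3 : ∀ (s w : V) (Ns Nw : ℕ), s ≠ 0 → w ≠ 0 → τ s = ε • s → τ w = (-ε) • w →
      TopIndep x s → 2 * Ns ≤ dp s + 1 → 2 * Nw ≤ dp w → ∀ b : ℕ, ∃ ℓ, b < ℓ ∧ Kol ℓ ∧ x ∈ A ℓ ∧
        (((p : ℤ) ^ Ns) • s ∈ A ℓ ∧ (Ns ≠ 0 → ((p : ℤ) ^ (Ns - 1)) • s ∉ A ℓ)) ∧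
        (((p : ℤ) ^ Nw) • w ∈ A ℓ ∧ (Nw ≠ 0 → ((p : ℤ) ^ (Nw - 1)) • w ∉ A ℓ)))
    {s : V} (hs : s ∈ Sel) :
    ((p : ℤ) ^ (2 * M₀ + 1)) • s ∈ AddSubgroup.zmultiples x := by
  obtain ⟨u, hu⟩ := exists_two_mul_zsmul_eq_of_pow hp hp2 htor
  have he := sign_mul_self hε
  set sp := u • (s + ε • τ s) with hsp
  set sm := u • (s - ε • τ s) with hsm
  have hτsp : τ sp = ε • sp := by
    simp only [hsp, map_zsmul, map_add, hττ]
    linear_combination (norm := module) he • (-(u • τ s))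
  have hτsm : τ sm = (-ε) • sm := by
    simp only [hsm, map_zsmul, map_sub, hττ]
    linear_combination (norm := module) he • (-(u • τ s))
  have hsp_mem : sp ∈ Sel := Sel.zsmul_mem (Sel.add_mem hs (Sel.zsmul_mem (hτSel s hs) _)) _
  have hsm_mem : sm ∈ Sel := Sel.zsmul_mem (Sel.sub_mem hs (Sel.zsmul_mem (hτSel s hs) _)) _
  have hsm0 : ((p : ℤ) ^ (2 * M₀ + 1)) • sm = 0 :=
    pow_zsmul_eq_zero_of_le (by omega)
      (claimA_borel hε htor hKol hdv hxord hτx hc1 hτc hcloc hc44 hdual hdp hceb2 hsm_mem hτsm)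
  obtain ⟨a, ha⟩ := claimB_borel hε htor hSel hKol hdv hdvm hxSel hxord hτx hc1 hτc hcloc hc44 hdual hdp
    hsplit hceb1 hceb3 hsp_mem hτsp
  have hsum : s = sp + sm := by
    simp only [hsp, hsm]
    linear_combination (norm := module) (-1 : ℤ) • hu s
  rw [hsum, zsmul_add, hsm0, add_zero, ha]
  exact AddSubgroup.zsmul_mem_zmultiples _ _

/-- **The `ε`-part keeps the verbatim exponent: `p^{2M₀}·Sel^{ε}... ⊆ ℤx` given one step-A prime with an
even-depth class**, restated: for `s ∈ Sel` the `ε`-component `u(s + ετs)` satisfies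
`p^{2M₀} u(s + ετs) ∈ ℤx`. (The `(−ε)`-part is where the Borel prime genuinely costs: depth-1 classes of
sign `−ε` are blind, so no descent of this kind bounds `Sel^{−ε}` below `p·Sel^{−ε}`; at `M₀ = 0` the
verbatim `Sel^{−ε} = 0` is out of reach of the method.) [cite: GrossLMS1991, §10 Claim 10.3] -/
theorem pow_zsmul_eigen_mem_zmultiples_borel_of_even (hε : ε = 1 ∨ ε = -1)
    (htor : ∀ v : V, ((p : ℤ) ^ M) • v = 0) (hττ : ∀ v, τ (τ v) = v)
    (hτSel : ∀ s ∈ Sel, τ s ∈ Sel) (hSel : ∀ s, s ∈ Sel ↔ ∀ v, s ∈ Loc v)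
    (hKol : ∀ ℓ, Kol ℓ → ℓ.Prime) (hdv : ∀ ℓ, Kol ℓ → ∀ v, Dv v ℓ ↔ v = pl ℓ)
    (hdvm : ∀ ℓ ℓ', Kol ℓ → Kol ℓ' → ∀ v, Dv v (ℓ * ℓ') → Dv v ℓ ∨ Dv v ℓ')
    (hxSel : x ∈ Sel) (hτx : τ x = ε • x)
    (hc1 : c 1 = ((p : ℤ) ^ M₀) • x)
    (hτc : ∀ n, KolSupp Kol n → τ (c n) = (ε * (-1) ^ n.primeFactors.card) • c n)
    (hcloc : ∀ n, KolSupp Kol n → ∀ v, ¬ Dv v n → c n ∈ Loc v)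
    (hc44 : ∀ ℓ m, Kol ℓ → KolSupp Kol (ℓ * m) → ∀ a : ℕ,
      (((p : ℤ) ^ a) • c (ℓ * m) ∈ Loc (pl ℓ)) ↔ ((p : ℤ) ^ a) • c m ∈ A ℓ)
    (hdual : ∀ ℓ, Kol ℓ → ∀ ν : ℤ, (ν = 1 ∨ ν = -1) → ∀ d, τ d = ν • d →
      (∀ v, v ≠ pl ℓ → d ∈ Loc v) → ∀ s ∈ Sel, τ s = ν • s →
      ∀ a, a < M → ((p : ℤ) ^ a) • d ∉ Loc (pl ℓ) → ((p : ℤ) ^ (M - 1 - a)) • s ∈ A ℓ)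
    (hdp : ∀ (v : V) (a : ℕ), ((p : ℤ) ^ a) • v = 0 ↔ dp v ≤ 2 * a)
    (hsplit : ∀ s, τ s = ε • s → ∃ (k : ℤ) (s' : V), s = k • x + s' ∧ TopIndep x s')
    (hceb3 : ∀ (s w : V) (Ns Nw : ℕ), s ≠ 0 → w ≠ 0 → τ s = ε • s → τ w = (-ε) • w →
      TopIndep x s → 2 * Ns ≤ dp s + 1 → 2 * Nw ≤ dp w → ∀ b : ℕ, ∃ ℓ, b < ℓ ∧ Kol ℓ ∧ x ∈ A ℓ ∧
        (((p : ℤ) ^ Ns) • s ∈ A ℓ ∧ (Ns ≠ 0 → ((p : ℤ) ^ (Ns - 1)) • s ∉ A ℓ)) ∧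
        (((p : ℤ) ^ Nw) • w ∈ A ℓ ∧ (Nw ≠ 0 → ((p : ℤ) ^ (Nw - 1)) • w ∉ A ℓ)))
    {ℓ : ℕ} (hℓ : Kol ℓ) (hd : ((p : ℤ) ^ (M - M₀ - 1)) • c ℓ ∉ Loc (pl ℓ))
    (heven : Even (dp (c ℓ))) (u : ℤ) {s : V} (hs : s ∈ Sel) :
    ((p : ℤ) ^ (2 * M₀)) • (u • (s + ε • τ s)) ∈ AddSubgroup.zmultiples x := by
  have he := sign_mul_self hε
  have hτsp : τ (u • (s + ε • τ s)) = ε • (u • (s + ε • τ s)) := by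
    simp only [map_zsmul, map_add, hττ]
    linear_combination (norm := module) he • (-(u • τ s))
  have hsp_mem : u • (s + ε • τ s) ∈ Sel :=
    Sel.zsmul_mem (Sel.add_mem hs (Sel.zsmul_mem (hτSel s hs) _)) _
  obtain ⟨a, ha⟩ := claimB_borel_of_even hε htor hSel hKol hdv hdvm hxSel hτx hc1 hτc hcloc hc44 hdual
    hdp hsplit hceb3 hℓ hd heven hsp_mem hτsp
  rw [ha]
  exact AddSubgroup.zsmul_mem_zmultiples _ _

end Annihilation

/-! ## §5 From annihilation at every level to `Ш(E/K)[p^∞]` (descent data abstracted away) -/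

section Sha

open NumberField IsDedekindDomain

variable {F : Type u} [Field F] [NumberField F] (E : WeierstrassCurve F)

/-- **`p^C·Ш(E/K)[p^∞] = 0`, hence `Ш(E/K)[p^∞]` is finite, from an annihilation `p^C·Sel^{(p^j)}(E/K) ⊆ ℤx_j`
at every level `j` with `x_j` dying in `H¹(K, E)`** (e.g. `x_j = δ_j x₀`). This is the tree's
`finite_sha_primary_of_hypothesesM` with the descent replaced by its OUTPUT, so that any variant descent —
here `pow_zsmul_mem_zmultiples_borel` with `C = 2M₀ + 1` — feeds it: a class `c ∈ Ш(E/K)` killed by `p^j`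
lifts to `Sel^{(p^j)}` (Silverman X.4.2(a), tree `map_torsionH1ToH1_selmerGroup_holds`), its `p^C`-multiple
lies in `ℤx_j`, which dies in `H¹(K, E)`; then `finite_sha_primary_of_pow_smul_eq_zero` (X.4.2(b)).
[cite: SilvermanAEC2009, Thm X.4.2] [cite: GrossLMS1991, §1 Thm. 1.3 (2)] -/
theorem finite_sha_primary_of_forall_pow_zsmul_mem_zmultiples [E.IsElliptic] {p : ℕ} (hp : p.Prime)
    (C : ℕ) (x : ∀ j : ℕ, galH1Torsion E ((p ^ j : ℕ) : ℤ))
    (hx : ∀ j, x j ∈ (torsionH1ToH1 E ((p ^ j : ℕ) : ℤ)).ker)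
    (hann : ∀ j, ∀ s ∈ selmerGroup E ((p ^ j : ℕ) : ℤ),
      ((p : ℤ) ^ C) • s ∈ AddSubgroup.zmultiples (x j)) :
    Set.Finite {c : E.sha | ∃ j : ℕ, p ^ j • c = 0} := by
  refine E.finite_sha_primary_of_pow_smul_eq_zero hp.ne_zero (M := C) fun c ⟨j, hj⟩ ↦ ?_
  have hn : ((p ^ j : ℕ) : ℤ) ≠ 0 := by exact_mod_cast pow_ne_zero j hp.ne_zero
  -- `c ∈ Ш ∩ H¹(K, E)[p^j]` lifts to the Selmer group
  have hc' : (c : E.galH1) ∈ E.sha ⊓ AddSubgroup.torsionBy E.galH1 ((p ^ j : ℕ) : ℤ) := by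
    refine AddSubgroup.mem_inf.mpr ⟨c.2, ?_⟩
    rw [mem_torsionBy_iff, natCast_zsmul, ← AddSubgroupClass.coe_nsmul, hj, ZeroMemClass.coe_zero]
  rw [← E.map_torsionH1ToH1_selmerGroup_holds hn, AddSubgroup.mem_map] at hc'
  obtain ⟨s, hs, hts⟩ := hc'
  -- `p^C s ∈ ℤ x_j ⊆ ker (H¹(K, E[p^j]) → H¹(K, E))`
  have hmem := hann j s hs
  have hker : AddSubgroup.zmultiples (x j) ≤ (torsionH1ToH1 E ((p ^ j : ℕ) : ℤ)).ker :=
    AddSubgroup.zmultiples_le_of_mem (hx j)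
  have h0 : torsionH1ToH1 E ((p ^ j : ℕ) : ℤ) (((p : ℤ) ^ C) • s) = 0 :=
    (AddMonoidHom.mem_ker).mp (hker hmem)
  rw [map_zsmul, hts] at h0
  apply Subtype.ext
  rw [AddSubgroupClass.coe_nsmul, ZeroMemClass.coe_zero, ← natCast_zsmul, Nat.cast_pow]
  exact h0

end Sha

end Summit.BirchSwinnertonDyer.BirchSwinnertonDyer.Theorems.PrintCFram.BorelDescent

end
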